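import Summits.Langlands.Langlands.Theses.RationalPeriodQuarter
import HarnessLib

/-!
# The rational eigencharacter lemma (route `RationalPeriodQuarter`, item `RationalEigencharacterLemma`)

We prove the statement item
`Summit.Langlands.Langlands.Theses.RationalPeriodQuarter.RationalEigencharacterLemma` outright:
if `V` is any `ℚ`-vector space, `T i` (`i : ι`) any family of `ℚ`-linear endomorphisms of `V` and
`w ∈ ℂ ⊗[ℚ] V` a non-zero simultaneous eigenvector of the base-changed operators
`(T i) ⊗ 1` with eigenvalues `a i ∈ ℂ`, then all `a i` lie in one intermediate field
`E` of `ℂ / ℚ` which is finite-dimensional over `ℚ` (a number field inside `ℂ`).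

## Proof (multiplier ring of the coordinate lattice; no descending chain is needed)

Choose a `ℚ`-basis `b` of `V` and let `Ψ : ℂ ⊗[ℚ] V →ₗ[ℚ] (K →₀ ℂ)` be the coordinate map
(`Ψ (c ⊗ v) k = (b.repr v k) • c`).  Every tensor is recovered from its coordinates,
`x = ∑ₖ (Ψ x k) ⊗ b k` (`eq_sum_coord`).  Let `Z ⊆ ℂ` be the `ℚ`-span of the finitely many
coordinates of `w`; it is finite-dimensional and non-zero.  The `ℚ`-span `M Z` of the pure tensors
`c ⊗ v` with `c ∈ Z` is stable under every `T ⊗ 1` (`baseChange_mem_span`), contains `w`, and all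
coordinates of its elements lie in `Z` (`coord_mem_of_mem_span`).  Hence the coordinates of
`a i • w = (T i ⊗ 1) w`, namely `a i * Ψ w k` (`coord_smul`), lie in `Z`, i.e. `a i • Z ⊆ Z`.
So every `a i` lies in the multiplier algebra `O = {c ∈ ℂ | c • Z ⊆ Z}`, a `ℚ`-subalgebra of `ℂ`
which embeds `ℚ`-linearly into `End_ℚ(Z)` (as `Z ≠ 0`), hence is finite-dimensional, hence
(a finite-dimensional domain) a field; `E := O` viewed as an intermediate field does the job.
-/

set_option linter.dupNamespace false

noncomputable section

open TensorProduct

namespace Summit.Langlands.Langlands.Theorems.RationalPeriodQuarterEigencharacter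

section Coordinates

variable {V : Type*} [AddCommGroup V] [Module ℚ V] {K : Type*}

/-- The concrete coordinate map `ℂ ⊗[ℚ] V → (K →₀ ℂ)` attached to a basis `b` of `V`
evaluates on pure tensors by `Ψ (c ⊗ v) k = (b.repr v k) • c`. -/
theorem coord_tmul [DecidableEq K] (b : Module.Basis K ℚ V) (c : ℂ) (v : V) (k : K) :
    ((finsuppScalarRight ℚ ℚ ℂ K).toLinearMap ∘ₗ (b.repr.toLinearMap).lTensor ℂ) (c ⊗ₜ[ℚ] v) k
      = (b.repr v k) • c := by
  simp

variable (b : Module.Basis K ℚ V) (Ψ : ℂ ⊗[ℚ] V →ₗ[ℚ] (K →₀ ℂ))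
  (hΨ : ∀ (c : ℂ) (v : V) (k : K), Ψ (c ⊗ₜ[ℚ] v) k = (b.repr v k) • c)
include hΨ

/-- Coordinates are `ℂ`-homogeneous: `Ψ (a • x) k = a * Ψ x k`. -/
theorem coord_smul (a : ℂ) (x : ℂ ⊗[ℚ] V) (k : K) : Ψ (a • x) k = a * Ψ x k := by
  induction x using TensorProduct.induction_on with
  | zero => simp
  | tmul c v => simp [TensorProduct.smul_tmul', hΨ]
  | add x y hx hy => simp [smul_add, map_add, hx, hy, mul_add]

/-- Reconstruction of a tensor from its coordinates: `x = ∑ₖ (Ψ x k) ⊗ b k`. -/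
theorem eq_sum_coord (x : ℂ ⊗[ℚ] V) :
    x = (Ψ x).sum (fun k c ↦ c ⊗ₜ[ℚ] b k) := by
  induction x using TensorProduct.induction_on with
  | zero => simp
  | tmul c v =>
      have h1 : Ψ (c ⊗ₜ[ℚ] v) = (b.repr v).mapRange (fun q : ℚ ↦ (q • c : ℂ)) (by simp) := by
        ext k
        simp [hΨ]
      rw [h1, Finsupp.sum_mapRange_index (fun k ↦ by simp)]
      conv_lhs => rw [← b.linearCombination_repr v]
      rw [Finsupp.linearCombination_apply]
      simp only [Finsupp.sum, TensorProduct.tmul_sum, TensorProduct.smul_tmul]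
  | add x y hx hy =>
      rw [map_add, Finsupp.sum_add_index' (fun k ↦ by simp)
        (fun k c₁ c₂ ↦ by simp [TensorProduct.add_tmul]), ← hx, ← hy]

/-- All coordinates of an element of the `ℚ`-span of the pure tensors `c ⊗ v`, `c ∈ Z`,
lie in `Z`. -/
theorem coord_mem_of_mem_span {Z : Submodule ℚ ℂ} {x : ℂ ⊗[ℚ] V}
    (hx : x ∈ Submodule.span ℚ {x : ℂ ⊗[ℚ] V | ∃ c ∈ Z, ∃ v : V, c ⊗ₜ[ℚ] v = x}) (k : K) :
    Ψ x k ∈ Z := by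
  induction hx using Submodule.span_induction with
  | mem x hx =>
      obtain ⟨c, hc, v, rfl⟩ := hx
      rw [hΨ]
      exact Z.smul_mem _ hc
  | zero => simp
  | add x y _ _ hx hy => simpa using Z.add_mem hx hy
  | smul q x _ hx => simpa using Z.smul_mem q hx

omit hΨ in
/-- The `ℚ`-span of the pure tensors `c ⊗ v`, `c ∈ Z`, is stable under every base-changed
operator `T ⊗ 1`. -/
theorem baseChange_mem_span {Z : Submodule ℚ ℂ} (T : V →ₗ[ℚ] V) {x : ℂ ⊗[ℚ] V}
    (hx : x ∈ Submodule.span ℚ {x : ℂ ⊗[ℚ] V | ∃ c ∈ Z, ∃ v : V, c ⊗ₜ[ℚ] v = x}) :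
    (T.baseChange ℂ) x ∈ Submodule.span ℚ {x : ℂ ⊗[ℚ] V | ∃ c ∈ Z, ∃ v : V, c ⊗ₜ[ℚ] v = x} := by
  induction hx using Submodule.span_induction with
  | mem x hx =>
      obtain ⟨c, hc, v, rfl⟩ := hx
      exact Submodule.subset_span ⟨c, hc, T v, by simp⟩
  | zero => simp
  | add x y _ _ hx hy => simpa using add_mem hx hy
  | smul q x _ hx =>
      rw [LinearMap.map_smul_of_tower]
      exact Submodule.smul_mem _ q hx

end Coordinates

open Summit.Langlands.Langlands.Theses.RationalPeriodQuarter in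
/-- **The rational eigencharacter lemma** — closes the route item
`RationalPeriodQuarter.RationalEigencharacterLemma` by name. -/
theorem rationalEigencharacterLemma : RationalEigencharacterLemma := by
  intro V _ _ ι T a w hw hT
  classical
  -- coordinates with respect to a `ℚ`-basis of `V`
  let b := Module.Basis.ofVectorSpace ℚ V
  let Ψ : ℂ ⊗[ℚ] V →ₗ[ℚ] (Module.Basis.ofVectorSpaceIndex ℚ V →₀ ℂ) :=
    (finsuppScalarRight ℚ ℚ ℂ _).toLinearMap ∘ₗ (b.repr.toLinearMap).lTensor ℂ
  have hΨ : ∀ (c : ℂ) (v : V) (k : Module.Basis.ofVectorSpaceIndex ℚ V),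
      Ψ (c ⊗ₜ[ℚ] v) k = (b.repr v k) • c := coord_tmul b
  -- the coordinate lattice `Z` of `w`
  set z := Ψ w with hz
  let Z : Submodule ℚ ℂ := Submodule.span ℚ (Set.range z)
  have hZfin : FiniteDimensional ℚ Z := by
    refine FiniteDimensional.span_of_finite ℚ (((z.frange.finite_toSet).insert 0).subset ?_)
    rintro _ ⟨k, rfl⟩
    by_cases hk : z k = 0
    · simp [hk]
    · exact Set.mem_insert_of_mem _ (Finset.mem_coe.2 (Finsupp.mem_frange.2 ⟨hk, k, rfl⟩))
  have hwM : w ∈ Submodule.span ℚ {x : ℂ ⊗[ℚ] V | ∃ c ∈ Z, ∃ v : V, c ⊗ₜ[ℚ] v = x} := by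
    rw [eq_sum_coord b Ψ hΨ w]
    exact Submodule.sum_mem _ fun k _ ↦
      Submodule.subset_span ⟨z k, Submodule.subset_span ⟨k, rfl⟩, b k, rfl⟩
  -- stability: `a i • Z ⊆ Z`
  have hstab : ∀ i, ∀ x ∈ Z, a i * x ∈ Z := by
    intro i
    have hk : ∀ k, a i * z k ∈ Z := by
      intro k
      have h := coord_mem_of_mem_span b Ψ hΨ (baseChange_mem_span (Z := Z) (T i) hwM) k
      rwa [hT i, coord_smul b Ψ hΨ] at h
    intro x hx
    induction hx using Submodule.span_induction with
    | mem x hx =>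
        obtain ⟨k, rfl⟩ := hx
        exact hk k
    | zero => simp
    | add x y _ _ hx hy =>
        rw [mul_add]
        exact add_mem hx hy
    | smul q x _ hx =>
        rw [mul_smul_comm]
        exact Z.smul_mem q hx
  -- `Z ≠ 0`
  have hz_ne : z ≠ 0 := by
    intro hz0
    apply hw
    have h3 := eq_sum_coord b Ψ hΨ w
    rwa [← hz, hz0, Finsupp.sum_zero_index] at h3
  obtain ⟨k₀, hk₀'⟩ := Finsupp.support_nonempty_iff.2 hz_ne
  have hk₀ : z k₀ ≠ 0 := Finsupp.mem_support_iff.1 hk₀'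
  -- the multiplier algebra of `Z`
  let O : Subalgebra ℚ ℂ :=
    { carrier := {c : ℂ | ∀ x ∈ Z, c * x ∈ Z}
      mul_mem' := fun {c d} hc hd x hx ↦ by
        rw [mul_assoc]
        exact hc _ (hd x hx)
      one_mem' := fun x hx ↦ by simpa using hx
      add_mem' := fun {c d} hc hd x hx ↦ by
        rw [add_mul]
        exact add_mem (hc x hx) (hd x hx)
      zero_mem' := fun x hx ↦ by simp
      algebraMap_mem' := fun q x hx ↦ by
        rw [← Algebra.smul_def]
        exact Z.smul_mem q hx }
  have hmemO : ∀ i, a i ∈ O := hstab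
  -- `O` is finite-dimensional: it embeds into `End_ℚ(Z)`
  have hOfin : FiniteDimensional ℚ O := by
    let φ : O →ₗ[ℚ] (Z →ₗ[ℚ] Z) :=
      { toFun := fun c ↦ (LinearMap.mulLeft ℚ (c : ℂ)).restrict (fun x hx ↦ c.2 x hx)
        map_add' := fun c d ↦ by
          ext x
          simp [add_mul]
        map_smul' := fun q c ↦ by
          ext x
          simp }
    refine Module.Finite.of_injective φ ?_
    intro c d hcd
    have h := congrArg
      (fun f : Z →ₗ[ℚ] Z ↦ ((f ⟨z k₀, Submodule.subset_span ⟨k₀, rfl⟩⟩ : Z) : ℂ)) hcd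
    simp only [φ, LinearMap.coe_mk, AddHom.coe_mk, LinearMap.restrict_apply,
      LinearMap.mulLeft_apply] at h
    exact Subtype.ext (mul_right_cancel₀ hk₀ h)
  -- hence a field
  haveI := hOfin
  have hOfield : IsField O :=
    { exists_pair_ne := ⟨0, 1, zero_ne_one⟩
      mul_comm := mul_comm
      mul_inv_cancel := fun {x} hx ↦ (FiniteDimensional.isUnit ℚ hx).exists_right_inv }
  refine ⟨O.toIntermediateField' hOfield, ?_, fun i ↦ ?_⟩
  · exact hOfin
  · show a i ∈ O
    exact hmemO i

end Summit.Langlands.Langlands.Theorems.RationalPeriodQuarterEigencharacter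

end
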